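import Mathlib
import Literature.MathematicalPhysics.QuantumFieldTheory.Balaban1983to89.B5ToronDeltaA169

/-!
# B5 Prop. 1.1 (1.89) ⟹ (1.90) AT A CONSTANT ABELIAN BACKGROUND ("TORON TWINS", fourth file): the bound from
# below `Δ^ω_a ≥ γ(d,a)·(Δ_ω + I)` for the twisted `Δ_a`, from per-coset inverse blocks with the (1.89) weights

statement-level skeleton of published theorems with citation tags; proofs where landed; nothing here is a claim
about the Yang–Mills mass gap

Sources.  T. Bałaban, *Propagators and renormalization transformations for lattice gauge theories. I*, Commun.
Math. Phys. **95** (1984) 17–40 [Balaban1984PropagatorsI] ("B5"): Prop. 1.1 (1.89)/(1.90) p. 33, (1.83) p. 31,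
(1.69)/(1.73) pp. 29–30.  T. Bałaban, *Propagators for lattice gauge theories in a background field*, Commun.
Math. Phys. **99** (1985) 389–434 [Balaban1985BackgroundPropagators] ("B9"): (3.26) p. 395, Thm 3.11 p. 416.

## What the papers print (verbatim)

[B5] p. 33: «Proposition 1.1. The operator G is a symmetric operator on L²(T_η) and ‖GJ‖, ‖∇GJ‖, ‖G∇*J‖,
‖∇G∇*J‖, ‖∇∇GJ‖, ‖G∇*∇*J‖ ≤ γ₀⁻¹‖J‖, (1.89) with a positive constant γ₀ independent of k, T_η, and depending on
d only (if we put a = 1). This implies the bound from below: Δ_a = G⁻¹ ≥ γ₀(Δ + I). (1.90)».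
[B9] p. 416, Thm 3.11: positivity of `Δ_a(U)` for regular backgrounds; p. 395: «It coincides with Δ_a … if U = 1».

## What this module certifies (kernel-checked, 0 `sorry`)

The flat inference (1.89) ⟹ (1.90) of `B5Prop11Lower` §5 (Cauchy–Schwarz in the `𝒢`-form + the Plancherel block
bound of `B5Prop11Plancherel` §5), re-run for the TWISTED `Δ^ω_a = DeltaATw n M a ω` of `B5ToronMomentum161` and
an ARBITRARY family of per-coset inverse blocks:
* §1 `blockOp B` — the operator on `ℓ²(T_η; ℂ^d)` with Fourier blocks `B(p′)` over the cosets (the shape of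
  `calG`/`calDa`), its algebra (`blockOp_mul`, `blockOp_one`, Hermitian/positive from the blocks), the weighted form
  `mulWB` with the twisted multipliers (`fdiffTw_mul_mulWB`, `mulWB_mul_star_fdiffTw`, `reindex_conj_mulWB`) and
  the Plancherel bound `opNorm_mulWB_le`; `eq_blockOp_of_fiber` (an operator whose `dftV`-image acts coset by
  coset through `B` IS `blockOp B`).
* §2 `VbTw` (`V_none = 1`, `V_ν = ∇^ω_ν`, so `Σ_α V_α^*V_α = Δ_ω + I`), and **`b05Tw_form_lower`**: IF `G(p′)` are
  blocks with `Δ^ω_a · blockOp G = 1`, each `G(p′) ≥ 0`, and the four (1.89) sandwich bounds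
  `‖D_{w_α} G(p′) D_{w_β}^*‖ ≤ Cst(d,a)` for the twisted weights `w ∈ {1, ssymTw_ν(p′+·)}`, THEN
  `(1/((d+1)·Cst(d,a)))·Σ_w‖A w‖² ≤ re⟨A, Δ^ω_aA⟩` — the twin of `B5Eq190FlatCoercivityUniform.b05_form_lower`,
  with the SAME volume-free constant.
* NOT HERE: the discharge of the three §2 hypotheses at a unit twist `ω = twistOf φ` — per coset, after
  re-centring the shifted momentum `s′ = p′ + nφ` into `(−π, π]^d` (`s′ ↦ s′ − 2πm`, `l ↦ l + m mod n`), the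
  inverse block is pass 5's `(balabanFiber n hn a ha s″ …).G` (`s″ ≠ 0`) or B5's `p′ = 0` block `G₀` (`s″ = 0`),
  with `B5Prop11Fiber.opNorm_sandwich_G_le_of_orders` / `B5Prop11Plancherel.opNorm_sandwich_G₀_le_of_orders`
  supplying the (1.89) bounds — is the sequel module (re-centring bookkeeping); this module is twist-generic.

HONEST SCOPE.  (H1) the inverse blocks `G(p′)`, their positivity and their four (1.89) sandwich bounds are
HYPOTHESES of `b05Tw_form_lower` (displayed in its statement, not smuggled: at `ω = 1` they are exactly what
`B5Prop11Inverse.calDa_mul_calG`, `B5Prop11Lower.calG_posSemidef` and `B5Prop11Plancherel.block_bound_of_orders`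
prove for pass 5's blocks).  (H2) 0 `instance`, 0 `notation`, 0 new `def … : Prop`; NOT summit progress (rung R3 of
`ym3-torus` is YM₃ on T³ — not d = 4, not a mass gap, not Clay).
-/

open scoped BigOperators Matrix ComplexConjugate ComplexOrder Matrix.Norms.L2Operator
open Finset Complex

namespace Literature.MathematicalPhysics.QuantumFieldTheory.Balaban1983to89.B5ToronEq190

open Literature.MathematicalPhysics.QuantumFieldTheory.Balaban1983to89.B4Strip
open Literature.MathematicalPhysics.QuantumFieldTheory.Balaban1983to89.B5Prop11Bound
open Literature.MathematicalPhysics.QuantumFieldTheory.Balaban1983to89.B5Prop11Fiber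
open Literature.MathematicalPhysics.QuantumFieldTheory.Balaban1983to89.B5Prop11Plancherel
open Literature.MathematicalPhysics.QuantumFieldTheory.Balaban1983to89.B5Prop11Inverse
open Literature.MathematicalPhysics.QuantumFieldTheory.Balaban1983to89.B5Prop11Lower
open Literature.MathematicalPhysics.QuantumFieldTheory.Balaban1983to89.B5Action121
open Literature.MathematicalPhysics.QuantumFieldTheory.Balaban1983to89.B5Block118
open Literature.MathematicalPhysics.QuantumFieldTheory.Balaban1983to89.B5LaplaceInverse
open Literature.MathematicalPhysics.QuantumFieldTheory.Balaban1983to89.B5DeltaA169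
open Literature.MathematicalPhysics.QuantumFieldTheory.Balaban1983to89.B5ToronOperators118
open Literature.MathematicalPhysics.QuantumFieldTheory.Balaban1983to89.B5ToronMomentum161
open Literature.MathematicalPhysics.QuantumFieldTheory.Balaban1983to89.B5ToronDeltaA169

noncomputable section

/-! ## §1 Operators with Fourier blocks over the cosets -/

section BlockOp

variable {d : ℕ} (n : ℕ) [NeZero n] (M : Fin d → ℕ) [hM : ∀ μ, NeZero (M μ)]

/-- THE OPERATOR WITH FOURIER BLOCKS `B(p′)` over the cosets `p = p′ + l`: `U^* B̂ U`, `B̂` = the block family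
transported to (fine momentum, component) indices (the shape of (1.83)'s `𝒢` and (1.73)'s `𝒟_a` in passes 4–5,
for an arbitrary family). [cite: Balaban1984PropagatorsI, (1.83) p.31, (1.73) p.30] -/
def blockOp (B : Tor M → Matrix ((Fin d → Fin n) × Fin d) ((Fin d → Fin n) × Fin d) ℂ) :
    Matrix (Tor (fine n M) × Fin d) (Tor (fine n M) × Fin d) ℂ :=
  star (dftV (fine n M))
    * (Matrix.reindex (blockEquiv n M) (blockEquiv n M)).symm (Matrix.blockDiagonal B)
    * dftV (fine n M)

/-- transport of a product of block families. [cite: Balaban1984PropagatorsI, (1.83) p.31] -/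
theorem reindex_blockDiagonal_mul
    (B C : Tor M → Matrix ((Fin d → Fin n) × Fin d) ((Fin d → Fin n) × Fin d) ℂ) :
    (Matrix.reindex (blockEquiv n M) (blockEquiv n M)).symm (Matrix.blockDiagonal B)
        * (Matrix.reindex (blockEquiv n M) (blockEquiv n M)).symm (Matrix.blockDiagonal C)
      = (Matrix.reindex (blockEquiv n M) (blockEquiv n M)).symm
          (Matrix.blockDiagonal fun q => B q * C q) := by
  rw [Matrix.reindex_symm, Matrix.reindex_apply, Matrix.reindex_apply, Matrix.reindex_apply,
    Equiv.symm_symm, Matrix.submatrix_mul_equiv, ← Matrix.blockDiagonal_mul]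

/-- `blockOp B · blockOp C = blockOp (B·C)` (coset by coset). [cite: Balaban1984PropagatorsI, (1.83) p.31] -/
theorem blockOp_mul (B C : Tor M → Matrix ((Fin d → Fin n) × Fin d) ((Fin d → Fin n) × Fin d) ℂ) :
    blockOp n M B * blockOp n M C = blockOp n M (fun q => B q * C q) := by
  have hU : dftV (fine n M) * star (dftV (fine n M)) = 1 := dftV_mul_star (fine n M)
  rw [blockOp, blockOp, blockOp, ← reindex_blockDiagonal_mul]
  set X := (Matrix.reindex (blockEquiv n M) (blockEquiv n M)).symm (Matrix.blockDiagonal B)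
  set Y := (Matrix.reindex (blockEquiv n M) (blockEquiv n M)).symm (Matrix.blockDiagonal C)
  calc star (dftV (fine n M)) * X * dftV (fine n M) * (star (dftV (fine n M)) * Y * dftV (fine n M))
      = star (dftV (fine n M)) * X * (dftV (fine n M) * star (dftV (fine n M))) * Y * dftV (fine n M) := by
        simp only [Matrix.mul_assoc]
    _ = star (dftV (fine n M)) * (X * Y) * dftV (fine n M) := by
        rw [hU, Matrix.mul_one]
        simp only [Matrix.mul_assoc]

/-- `blockOp 1 = 1`. [cite: Balaban1984PropagatorsI, (1.83) p.31] -/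
theorem blockOp_one :
    blockOp n M (1 : Tor M → Matrix ((Fin d → Fin n) × Fin d) ((Fin d → Fin n) × Fin d) ℂ) = 1 := by
  rw [blockOp, Matrix.blockDiagonal_one, Matrix.reindex_symm, Matrix.reindex_apply,
    Matrix.submatrix_one_equiv, Matrix.mul_one, star_dftV_mul]

/-- blocks positive semidefinite ⟹ the operator is positive semidefinite. [cite: Balaban1984PropagatorsI, (1.90) p.33] -/
theorem blockOp_posSemidef {B : Tor M → Matrix ((Fin d → Fin n) × Fin d) ((Fin d → Fin n) × Fin d) ℂ}
    (h : ∀ q, (B q).PosSemidef) : (blockOp n M B).PosSemidef := by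
  have h1 : ((Matrix.reindex (blockEquiv n M) (blockEquiv n M)).symm (Matrix.blockDiagonal B)).PosSemidef := by
    rw [Matrix.reindex_symm, Matrix.reindex_apply, Equiv.symm_symm]
    exact (posSemidef_blockDiagonal _ h).submatrix _
  rw [blockOp, Matrix.star_eq_conjTranspose]
  exact h1.conjTranspose_mul_mul_same _

/-- the action of `blockOp B` read in momentum space, coset by coset.
[cite: Balaban1984PropagatorsI, (1.83) p.31] -/
theorem dftV_blockOp_mulVec (B : Tor M → Matrix ((Fin d → Fin n) × Fin d) ((Fin d → Fin n) × Fin d) ℂ)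
    (A : Tor (fine n M) × Fin d → ℂ) (k : Fin d → Fin n) (q : Tor M) (κ : Fin d) :
    (dftV (fine n M) *ᵥ (blockOp n M B *ᵥ A)) (pOf n M (k, q), κ)
      = (B q *ᵥ fun j => (dftV (fine n M) *ᵥ A) (pOf n M (j.1, q), j.2)) (k, κ) := by
  have hU : dftV (fine n M) * star (dftV (fine n M)) = 1 := dftV_mul_star (fine n M)
  have h1 : dftV (fine n M) *ᵥ (blockOp n M B *ᵥ A)
      = (Matrix.reindex (blockEquiv n M) (blockEquiv n M)).symm (Matrix.blockDiagonal B)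
          *ᵥ (dftV (fine n M) *ᵥ A) := by
    rw [blockOp, Matrix.mulVec_mulVec, Matrix.mulVec_mulVec, ← Matrix.mul_assoc, ← Matrix.mul_assoc, hU,
      Matrix.one_mul, ← Matrix.mulVec_mulVec]
  rw [h1, ← emb_eq, blockOp_mulVec]
  rfl

/-- AN OPERATOR IS `blockOp B` AS SOON AS ITS `dftV`-IMAGE ACTS COSET BY COSET THROUGH `B` (the argument of
`B5DeltaA169.calDa_eq_DeltaA`, for an arbitrary family). [cite: Balaban1984PropagatorsI, (1.73) p.30, (1.83) p.31] -/
theorem eq_blockOp_of_fiber (X : Matrix (Tor (fine n M) × Fin d) (Tor (fine n M) × Fin d) ℂ)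
    (B : Tor M → Matrix ((Fin d → Fin n) × Fin d) ((Fin d → Fin n) × Fin d) ℂ)
    (h : ∀ (A : Tor (fine n M) × Fin d → ℂ) (k : Fin d → Fin n) (q : Tor M) (κ : Fin d),
      (dftV (fine n M) *ᵥ (X *ᵥ A)) (pOf n M (k, q), κ)
        = (B q *ᵥ fun j => (dftV (fine n M) *ᵥ A) (pOf n M (j.1, q), j.2)) (k, κ)) :
    X = blockOp n M B := by
  have hvec : ∀ A : Tor (fine n M) × Fin d → ℂ,
      dftV (fine n M) *ᵥ (X *ᵥ A) = dftV (fine n M) *ᵥ (blockOp n M B *ᵥ A) := by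
    intro A
    funext I
    obtain ⟨J, rfl⟩ := (B5Prop11Plancherel.blockEquiv n M).symm.surjective I
    obtain ⟨⟨k, κ⟩, q⟩ := J
    rw [B5Prop11Plancherel.blockEquiv_symm_apply, emb_eq, h, dftV_blockOp_mulVec]
  have hmat : dftV (fine n M) * X = dftV (fine n M) * blockOp n M B :=
    B5Value126.ext_of_mulVec fun A => by rw [← Matrix.mulVec_mulVec, ← Matrix.mulVec_mulVec, hvec]
  calc X = star (dftV (fine n M)) * (dftV (fine n M) * X) := by
        rw [← Matrix.mul_assoc, star_dftV_mul, Matrix.one_mul]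
    _ = blockOp n M B := by rw [hmat, ← Matrix.mul_assoc, star_dftV_mul, Matrix.one_mul]

/-- `U^*(diag W₁ · B̂ · diag W₂^*)U`: `blockOp B` composed with Fourier multipliers on both sides (twin of
`B5Prop11Plancherel.mulW`). [cite: Balaban1984PropagatorsI, Prop. 1.1 (1.89) p.33] -/
def mulWB (B : Tor M → Matrix ((Fin d → Fin n) × Fin d) ((Fin d → Fin n) × Fin d) ℂ)
    (W₁ W₂ : Tor (fine n M) × Fin d → ℂ) :
    Matrix (Tor (fine n M) × Fin d) (Tor (fine n M) × Fin d) ℂ :=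
  star (dftV (fine n M))
    * (Matrix.diagonal W₁ * (Matrix.reindex (blockEquiv n M) (blockEquiv n M)).symm (Matrix.blockDiagonal B)
        * Matrix.diagonal (star W₂)) * dftV (fine n M)

/-- `blockOp B = mulWB B 1 1`. [cite: Balaban1984PropagatorsI, Prop. 1.1 (1.89) p.33] -/
theorem blockOp_eq_mulWB (B : Tor M → Matrix ((Fin d → Fin n) × Fin d) ((Fin d → Fin n) × Fin d) ℂ) :
    blockOp n M B = mulWB n M B (fun _ => 1) (fun _ => 1) := by
  have h1 : Matrix.diagonal (fun _ : Tor (fine n M) × Fin d => (1 : ℂ)) = 1 := Matrix.diagonal_one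
  have h2 : star (fun _ : Tor (fine n M) × Fin d => (1 : ℂ)) = fun _ => 1 := by
    funext i
    simp
  rw [mulWB, h2, h1, Matrix.one_mul, Matrix.mul_one, blockOp]

/-- `∇^ω_ν · mulWB W₁ W₂ = mulWB (fsymTw_ν·W₁) W₂`. [cite: Balaban1984PropagatorsI, Prop. 1.1 (1.89) p.33] -/
theorem fdiffTw_mul_mulWB (ω : Fin d → ℂ) (ν : Fin d)
    (B : Tor M → Matrix ((Fin d → Fin n) × Fin d) ((Fin d → Fin n) × Fin d) ℂ)
    (W₁ W₂ : Tor (fine n M) × Fin d → ℂ) :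
    fdiffTw (fine n M) (n : ℂ) ω ν * mulWB n M B W₁ W₂
      = mulWB n M B (fun i => fsymTw (fine n M) (n : ℂ) ω ν i * W₁ i) W₂ := by
  rw [fdiffTw_eq, mulWB, mulWB]
  have hU := dftV_mul_star (fine n M)
  set U := dftV (fine n M)
  set X := (Matrix.reindex (blockEquiv n M) (blockEquiv n M)).symm (Matrix.blockDiagonal B)
  calc star U * Matrix.diagonal (fsymTw (fine n M) (n : ℂ) ω ν) * U
        * (star U * (Matrix.diagonal W₁ * X * Matrix.diagonal (star W₂)) * U)
      = star U * Matrix.diagonal (fsymTw (fine n M) (n : ℂ) ω ν) * (U * star U)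
        * (Matrix.diagonal W₁ * X * Matrix.diagonal (star W₂)) * U := by
        simp only [Matrix.mul_assoc]
    _ = star U * (Matrix.diagonal (fun i => fsymTw (fine n M) (n : ℂ) ω ν i * W₁ i) * X
        * Matrix.diagonal (star W₂)) * U := by
        rw [hU, Matrix.mul_one, ← Matrix.diagonal_mul_diagonal]
        simp only [Matrix.mul_assoc]

/-- `mulWB W₁ W₂ · (∇^ω_ν)^* = mulWB W₁ (W₂·fsymTw_ν)`. [cite: Balaban1984PropagatorsI, Prop. 1.1 (1.89) p.33] -/
theorem mulWB_mul_star_fdiffTw (ω : Fin d → ℂ) (ν : Fin d)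
    (B : Tor M → Matrix ((Fin d → Fin n) × Fin d) ((Fin d → Fin n) × Fin d) ℂ)
    (W₁ W₂ : Tor (fine n M) × Fin d → ℂ) :
    mulWB n M B W₁ W₂ * star (fdiffTw (fine n M) (n : ℂ) ω ν)
      = mulWB n M B W₁ (fun i => W₂ i * fsymTw (fine n M) (n : ℂ) ω ν i) := by
  rw [star_fdiffTw_eq, mulWB, mulWB]
  have hU := dftV_mul_star (fine n M)
  set U := dftV (fine n M)
  set X := (Matrix.reindex (blockEquiv n M) (blockEquiv n M)).symm (Matrix.blockDiagonal B)
  have hd : Matrix.diagonal (star W₂) * Matrix.diagonal (star (fsymTw (fine n M) (n : ℂ) ω ν))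
      = Matrix.diagonal (star (fun i => W₂ i * fsymTw (fine n M) (n : ℂ) ω ν i)) := by
    rw [Matrix.diagonal_mul_diagonal]
    congr 1
    funext i
    simp
  calc star U * (Matrix.diagonal W₁ * X * Matrix.diagonal (star W₂)) * U
        * (star U * Matrix.diagonal (star (fsymTw (fine n M) (n : ℂ) ω ν)) * U)
      = star U * (Matrix.diagonal W₁ * X * Matrix.diagonal (star W₂)) * (U * star U)
        * Matrix.diagonal (star (fsymTw (fine n M) (n : ℂ) ω ν)) * U := by
        simp only [Matrix.mul_assoc]
    _ = star U * (Matrix.diagonal W₁ * X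
        * Matrix.diagonal (star (fun i => W₂ i * fsymTw (fine n M) (n : ℂ) ω ν i))) * U := by
        rw [hU, Matrix.mul_one, ← hd]
        simp only [Matrix.mul_assoc]

/-- the block structure of `U(mulWB W₁ W₂)U^*`: block `D_{w₁(p′)} B(p′) D_{w₂(p′)}^*` whenever the multipliers
restrict to the cosets as `W_i(p′+l) = w_i(p′)(l)` (twin of `reindex_conj_mulW`). [cite: Balaban1984PropagatorsI, Prop. 1.1 (1.89) p.33] -/
theorem reindex_conj_mulWB (B : Tor M → Matrix ((Fin d → Fin n) × Fin d) ((Fin d → Fin n) × Fin d) ℂ)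
    (W₁ W₂ : Tor (fine n M) × Fin d → ℂ) (w₁ w₂ : Tor M → (Fin d → Fin n) → ℂ)
    (e₁ : ∀ I, W₁ ((blockEquiv n M).symm I) = w₁ I.2 I.1.1)
    (e₂ : ∀ I, W₂ ((blockEquiv n M).symm I) = w₂ I.2 I.1.1) :
    Matrix.reindex (blockEquiv n M) (blockEquiv n M)
        (dftV (fine n M) * mulWB n M B W₁ W₂ * star (dftV (fine n M)))
      = Matrix.blockDiagonal (fun q => sandwich (w₁ q) (w₂ q) (B q)) := by
  have hU := dftV_mul_star (fine n M)
  have hY : dftV (fine n M) * mulWB n M B W₁ W₂ * star (dftV (fine n M))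
      = Matrix.diagonal W₁ * (Matrix.reindex (blockEquiv n M) (blockEquiv n M)).symm (Matrix.blockDiagonal B)
          * Matrix.diagonal (star W₂) := by
    rw [mulWB]
    set U := dftV (fine n M)
    set Y := Matrix.diagonal W₁ * (Matrix.reindex (blockEquiv n M) (blockEquiv n M)).symm (Matrix.blockDiagonal B)
      * Matrix.diagonal (star W₂)
    calc U * (star U * Y * U) * star U = (U * star U) * Y * (U * star U) := by
          simp only [Matrix.mul_assoc]
      _ = Y := by rw [hU, Matrix.one_mul, Matrix.mul_one]
  rw [hY]
  ext ⟨i, q⟩ ⟨j, q'⟩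
  have f₁ := e₁ (i, q)
  have f₂ := e₂ (j, q')
  simp only at f₁ f₂
  simp only [Matrix.reindex_apply, Matrix.submatrix_apply, Matrix.mul_diagonal, Matrix.diagonal_mul,
    Matrix.reindex_symm, Equiv.symm_symm, Equiv.apply_symm_apply,
    Matrix.blockDiagonal_apply', Pi.star_apply, Complex.star_def, f₁, f₂, sandwich]
  split_ifs with h
  · subst h
    rfl
  · simp

/-- THE PLANCHEREL BOUND for `mulWB`: per-coset sandwich bounds `≤ C` give `‖mulWB W₁ W₂‖ ≤ C`.
[cite: Balaban1984PropagatorsI, Prop. 1.1 (1.89) p.33] -/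
theorem opNorm_mulWB_le (B : Tor M → Matrix ((Fin d → Fin n) × Fin d) ((Fin d → Fin n) × Fin d) ℂ)
    (W₁ W₂ : Tor (fine n M) × Fin d → ℂ) (w₁ w₂ : Tor M → (Fin d → Fin n) → ℂ)
    (e₁ : ∀ I, W₁ ((blockEquiv n M).symm I) = w₁ I.2 I.1.1)
    (e₂ : ∀ I, W₂ ((blockEquiv n M).symm I) = w₂ I.2 I.1.1)
    {C : ℝ} (hC : 0 ≤ C) (hB : ∀ q, ‖sandwich (w₁ q) (w₂ q) (B q)‖ ≤ C) :
    ‖mulWB n M B W₁ W₂‖ ≤ C :=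
  opNorm_le_of_blocks (dftV_mem_unitaryGroup (fine n M)) (blockEquiv n M) _ _
    (reindex_conj_mulWB n M B W₁ W₂ w₁ w₂ e₁ e₂) hC hB

/-- restriction of the twisted symbol of `∇^ω_ν` to the cosets. [cite: Balaban1984PropagatorsI, (1.31) p.23] -/
theorem restrict_fsymTw (ω : Fin d → ℂ) (ν : Fin d) (I : ((Fin d → Fin n) × Fin d) × Tor M) :
    fsymTw (fine n M) (n : ℂ) ω ν ((blockEquiv n M).symm I)
      = ssymTw (fine n M) (n : ℂ) ω ν (pOf n M (I.1.1, I.2)) := by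
  obtain ⟨⟨k, μ⟩, q⟩ := I
  rw [B5Prop11Plancherel.blockEquiv_symm_apply, emb_eq]
  rfl

end BlockOp

/-! ## §2 The twisted (1.89) ⟹ (1.90) from per-coset inverse blocks -/

section Coercivity

variable {d : ℕ} (n : ℕ) [NeZero n] (M : Fin d → ℕ) [hM : ∀ μ, NeZero (M μ)] (a : ℝ) (ω : Fin d → ℂ)

/-- the twisted family `V_α`: `V_none = 1`, `V_ν = ∇^ω_ν` (twin of `B5Prop11Lower.Vb`).
[cite: Balaban1984PropagatorsI, (1.90) p.33] -/
def VbTw : Option (Fin d) → Matrix (Tor (fine n M) × Fin d) (Tor (fine n M) × Fin d) ℂ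
  | none => 1
  | some ν => fdiffTw (fine n M) (n : ℂ) ω ν

/-- `Σ_α V_α^*V_α = Δ_ω + I`. [cite: Balaban1984PropagatorsI, (1.90) p.33] -/
theorem sum_VbTwH_VbTw : ∑ α, (VbTw n M ω α)ᴴ * VbTw n M ω α = LapTw n M ω + 1 := by
  rw [Fintype.sum_option]
  simp only [VbTw, Matrix.conjTranspose_one, Matrix.mul_one, LapTw]
  rw [add_comm]

/-- `x^*(Δ_ω + I)x = Σ_α ‖V_α x‖²`. [cite: Balaban1984PropagatorsI, (1.90) p.33] -/
theorem form_LapOneTw (A : Tor (fine n M) × Fin d → ℂ) :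
    star A ⬝ᵥ ((LapTw n M ω + 1) *ᵥ A) = ((∑ α, nsq (VbTw n M ω α *ᵥ A) : ℝ) : ℂ) := by
  rw [← sum_VbTwH_VbTw, Matrix.sum_mulVec, dotProduct_sum, Complex.ofReal_sum]
  exact Finset.sum_congr rfl fun α _ => form_gram _ _

/-- `Δ_ω + I` is Hermitian. [cite: Balaban1984PropagatorsI, (1.90) p.33] -/
theorem LapOneTw_isHermitian : (LapTw n M ω + 1).IsHermitian := by
  rw [← sum_VbTwH_VbTw]
  exact Finset.sum_induction _ (fun X => Matrix.IsHermitian X) (fun _ _ ha hb => ha.add hb)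
    Matrix.isHermitian_zero (fun α _ => Matrix.isHermitian_conjTranspose_mul_self _)

/-- the twisted weights of (1.89): `w_none = 1`, `w_ν(p′)(l) = ssymTw_ν(p′ + l)`.
[cite: Balaban1984PropagatorsI, Prop. 1.1 (1.89) p.33] -/
def wTw : Option (Fin d) → Tor M → (Fin d → Fin n) → ℂ
  | none => fun _ _ => 1
  | some ν => fun q k => ssymTw (fine n M) (n : ℂ) ω ν (pOf n M (k, q))

/-- the four (1.89) bounds for the twisted inverse as ONE block statement: if every per-coset sandwich of `G(p′)`
by the twisted weights is `≤ Cst(d,a)`, then `‖V_α · blockOp G · V_β^*‖ ≤ Cst(d,a)` (twin of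
`B5Prop11Lower.opNorm_Vb_calG_VbH_le`). [cite: Balaban1984PropagatorsI, Prop. 1.1 (1.89) p.33] -/
theorem opNorm_VbTw_blockOp_VbTwH_le
    (G : Tor M → Matrix ((Fin d → Fin n) × Fin d) ((Fin d → Fin n) × Fin d) ℂ)
    (hG : ∀ (q : Tor M) (α β : Option (Fin d)),
      ‖sandwich (wTw n M ω α q) (wTw n M ω β q) (G q)‖ ≤ Cst d a)
    (α β : Option (Fin d)) :
    ‖VbTw n M ω α * blockOp n M G * (VbTw n M ω β)ᴴ‖ ≤ Cst d a := by
  have h1 : ∀ I : ((Fin d → Fin n) × Fin d) × Tor M,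
      (fun _ : Tor (fine n M) × Fin d => (1 : ℂ)) ((blockEquiv n M).symm I) = wTw n M ω none I.2 I.1.1 :=
    fun _ => rfl
  have hs : ∀ (ν : Fin d) (I : ((Fin d → Fin n) × Fin d) × Tor M),
      fsymTw (fine n M) (n : ℂ) ω ν ((blockEquiv n M).symm I) = wTw n M ω (some ν) I.2 I.1.1 :=
    fun ν I => restrict_fsymTw n M ω ν I
  rcases α with _ | ν <;> rcases β with _ | ν'
  · simp only [VbTw, Matrix.conjTranspose_one, Matrix.mul_one, Matrix.one_mul]
    rw [blockOp_eq_mulWB]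
    exact opNorm_mulWB_le n M G _ _ _ _ h1 h1 (Cst_nonneg d a) (fun q => hG q none none)
  · simp only [VbTw, Matrix.one_mul]
    rw [blockOp_eq_mulWB, ← Matrix.star_eq_conjTranspose, mulWB_mul_star_fdiffTw]
    refine opNorm_mulWB_le n M G _ _ _ _ h1 ?_ (Cst_nonneg d a) (fun q => hG q none (some ν'))
    intro I
    simp only [one_mul]
    exact hs ν' I
  · simp only [VbTw, Matrix.conjTranspose_one, Matrix.mul_one]
    rw [blockOp_eq_mulWB, fdiffTw_mul_mulWB]
    refine opNorm_mulWB_le n M G _ _ _ _ ?_ h1 (Cst_nonneg d a) (fun q => hG q (some ν) none)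
    intro I
    simp only [mul_one]
    exact hs ν I
  · simp only [VbTw]
    rw [blockOp_eq_mulWB, fdiffTw_mul_mulWB, ← Matrix.star_eq_conjTranspose, mulWB_mul_star_fdiffTw]
    refine opNorm_mulWB_le n M G _ _ _ _ ?_ ?_ (Cst_nonneg d a) (fun q => hG q (some ν) (some ν'))
    · intro I
      simp only [mul_one]
      exact hs ν I
    · intro I
      simp only [one_mul]
      exact hs ν' I

/-- the block estimate `re x^*(Δ_ω+I)·blockOp G·(Δ_ω+I)x ≤ (d+1)·Cst·Σ_α‖V_αx‖²` (twin of
`B5Prop11Lower.re_form_BGB_le`). [cite: Balaban1984PropagatorsI, (1.89) ⟹ (1.90) p.33] -/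
theorem re_form_BGB_le_Tw (G : Tor M → Matrix ((Fin d → Fin n) × Fin d) ((Fin d → Fin n) × Fin d) ℂ)
    (hG : ∀ (q : Tor M) (α β : Option (Fin d)),
      ‖sandwich (wTw n M ω α q) (wTw n M ω β q) (G q)‖ ≤ Cst d a)
    (A : Tor (fine n M) × Fin d → ℂ) :
    (star A ⬝ᵥ (((LapTw n M ω + 1) * blockOp n M G * (LapTw n M ω + 1)) *ᵥ A)).re
      ≤ ((d + 1 : ℝ) * Cst d a) * ∑ α, nsq (VbTw n M ω α *ᵥ A) := by
  set Gop := blockOp n M G with hGop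
  set s : Option (Fin d) → ℝ := fun α => Real.sqrt (nsq (VbTw n M ω α *ᵥ A)) with hs
  have hs0 : ∀ α, 0 ≤ s α := fun α => Real.sqrt_nonneg _
  have hs2 : ∀ α, s α ^ 2 = nsq (VbTw n M ω α *ᵥ A) := fun α => Real.sq_sqrt (nsq_nonneg _)
  have hexp : star A ⬝ᵥ (((LapTw n M ω + 1) * Gop * (LapTw n M ω + 1)) *ᵥ A)
      = ∑ α, ∑ β, star (VbTw n M ω α *ᵥ A) ⬝ᵥ
          ((VbTw n M ω α * Gop * (VbTw n M ω β)ᴴ) *ᵥ (VbTw n M ω β *ᵥ A)) := by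
    rw [← sum_VbTwH_VbTw, Finset.sum_mul, Finset.sum_mul, Matrix.sum_mulVec, dotProduct_sum]
    refine Finset.sum_congr rfl fun α _ => ?_
    rw [Finset.mul_sum, Matrix.sum_mulVec, dotProduct_sum]
    refine Finset.sum_congr rfl fun β _ => ?_
    exact form_sandwich5 _ _ _ _
  have hterm : ∀ α β, (star (VbTw n M ω α *ᵥ A) ⬝ᵥ
      ((VbTw n M ω α * Gop * (VbTw n M ω β)ᴴ) *ᵥ (VbTw n M ω β *ᵥ A))).re ≤ Cst d a * (s α * s β) := by
    intro α β
    refine (Complex.re_le_norm _).trans ?_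
    refine (norm_form_le _ _ _).trans ?_
    exact mul_le_mul_of_nonneg_right (opNorm_VbTw_blockOp_VbTwH_le n M a ω G hG α β)
      (mul_nonneg (hs0 α) (hs0 β))
  rw [hexp, Complex.re_sum]
  simp_rw [Complex.re_sum]
  calc ∑ α, ∑ β, (star (VbTw n M ω α *ᵥ A) ⬝ᵥ
          ((VbTw n M ω α * Gop * (VbTw n M ω β)ᴴ) *ᵥ (VbTw n M ω β *ᵥ A))).re
        ≤ ∑ α, ∑ β, Cst d a * (s α * s β) :=
          Finset.sum_le_sum fun α _ => Finset.sum_le_sum fun β _ => hterm α β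
    _ = Cst d a * (∑ α, s α) ^ 2 := by
          rw [sq, Finset.sum_mul_sum, Finset.mul_sum]
          refine Finset.sum_congr rfl fun α _ => ?_
          rw [Finset.mul_sum]
    _ ≤ Cst d a * ((Finset.univ : Finset (Option (Fin d))).card * ∑ α, s α ^ 2) :=
          mul_le_mul_of_nonneg_left (sq_sum_le_card_mul_sum_sq (s := Finset.univ) (f := s))
            (Cst_nonneg d a)
    _ = ((d + 1 : ℝ) * Cst d a) * ∑ α, nsq (VbTw n M ω α *ᵥ A) := by
          rw [Finset.card_univ, Fintype.card_option, Fintype.card_fin]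
          simp_rw [hs2]
          push_cast
          ring

/-- THE KEY INEQUALITY `Σ_α‖V_αx‖² ≤ (d+1)·Cst·re x^*Δ^ω_ax` for the twisted operator, given per-coset inverse
blocks `G(p′) ≥ 0` with `Δ^ω_a·blockOp G = 1` and the four (1.89) sandwich bounds (twin of
`B5Prop11Lower.form_LapOne_le`: Cauchy–Schwarz in the `blockOp G`-form). [cite: Balaban1984PropagatorsI, (1.89) ⟹ (1.90) p.33] -/
theorem form_LapOneTw_le (G : Tor M → Matrix ((Fin d → Fin n) × Fin d) ((Fin d → Fin n) × Fin d) ℂ)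
    (hDG : DeltaATw n M a ω * blockOp n M G = 1) (hGpsd : ∀ q, (G q).PosSemidef)
    (hG : ∀ (q : Tor M) (α β : Option (Fin d)),
      ‖sandwich (wTw n M ω α q) (wTw n M ω β q) (G q)‖ ≤ Cst d a)
    (A : Tor (fine n M) × Fin d → ℂ) :
    ∑ α, nsq (VbTw n M ω α *ᵥ A)
      ≤ ((d + 1 : ℝ) * Cst d a) * (star A ⬝ᵥ (DeltaATw n M a ω *ᵥ A)).re := by
  set Gop := blockOp n M G with hGop
  set D := DeltaATw n M a ω with hD
  set B := LapTw n M ω + 1 with hB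
  have hGD : Gop * D = 1 := mul_eq_one_comm.mp hDG
  have hGpsd' : Gop.PosSemidef := blockOp_posSemidef n M hGpsd
  have hGh : Gop.IsHermitian := hGpsd'.1
  have hDinv : D = Gop⁻¹ := (Matrix.inv_eq_left_inv hDG).symm
  have hDpsd : D.PosSemidef := by
    rw [hDinv]
    exact hGpsd'.inv
  have hDh : D.IsHermitian := hDpsd.1
  have hBh : B.IsHermitian := LapOneTw_isHermitian n M ω
  set K := D *ᵥ A with hK
  set g : ℝ := ∑ α, nsq (VbTw n M ω α *ᵥ A) with hg
  set f : ℝ := (star A ⬝ᵥ (D *ᵥ A)).re with hf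
  have hA : Gop *ᵥ K = A := by rw [hK, Matrix.mulVec_mulVec, hGD, Matrix.one_mulVec]
  have e1 : star A ⬝ᵥ (B *ᵥ A) = star K ⬝ᵥ (Gop *ᵥ (B *ᵥ A)) := by
    conv_lhs => rw [← hA]
    rw [Matrix.star_mulVec, hGh.eq, ← Matrix.dotProduct_mulVec, hA]
  have e2 : (star K ⬝ᵥ (Gop *ᵥ K)).re = f := by
    rw [hA, hK, Matrix.star_mulVec, hDh.eq, ← Matrix.dotProduct_mulVec]
  have e3 : star (B *ᵥ A) ⬝ᵥ (Gop *ᵥ (B *ᵥ A)) = star A ⬝ᵥ ((B * Gop * B) *ᵥ A) := by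
    rw [Matrix.star_mulVec, hBh.eq, ← Matrix.dotProduct_mulVec, Matrix.mulVec_mulVec,
      Matrix.mulVec_mulVec]
  have h3 : (star (B *ᵥ A) ⬝ᵥ (Gop *ᵥ (B *ᵥ A))).re ≤ ((d + 1 : ℝ) * Cst d a) * g := by
    rw [e3]
    exact re_form_BGB_le_Tw n M a ω G hG A
  have e4 : star A ⬝ᵥ (B *ᵥ A) = (g : ℂ) := form_LapOneTw n M ω A
  have hg0 : 0 ≤ g := Finset.sum_nonneg fun α _ => nsq_nonneg _
  have hf0 : 0 ≤ f := form_re_nonneg_of_posSemidef hDpsd A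
  have hM0 : 0 ≤ (d + 1 : ℝ) * Cst d a := by
    have := Cst_nonneg d a
    positivity
  have cs := norm_sq_form_le_of_posSemidef hGpsd' K (B *ᵥ A)
  rw [← e1, e4, Complex.norm_real, Real.norm_eq_abs, sq_abs, e2] at cs
  have main : g ^ 2 ≤ f * (((d + 1 : ℝ) * Cst d a) * g) :=
    cs.trans (mul_le_mul_of_nonneg_left h3 hf0)
  by_cases hgz : g = 0
  · rw [hgz]
    exact mul_nonneg hM0 hf0
  · have hgpos : 0 < g := lt_of_le_of_ne hg0 (Ne.symm hgz)
    nlinarith [main, hgpos, hf0, hM0]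

/-- **THE TWISTED (1.90) AS A FORM INEQUALITY, FROM PER-COSET INVERSE BLOCKS** (twin of
`B5Eq190FlatCoercivityUniform.b05_form_lower`, same volume-free constant `γ(d,a) = 1/((d+1)·Cst(d,a))`): if the
blocks `G(p′) ≥ 0` invert the twisted `Δ^ω_a` coset-wise (`Δ^ω_a·blockOp G = 1`) and satisfy the four (1.89) sandwich
bounds for the twisted weights, then `γ(d,a)·Σ_w‖A w‖² ≤ re⟨A, Δ^ω_aA⟩`.
[cite: Balaban1984PropagatorsI, Prop. 1.1 (1.90) p.33; Balaban1985BackgroundPropagators, Thm 3.11 p.416] -/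
theorem b05Tw_form_lower (G : Tor M → Matrix ((Fin d → Fin n) × Fin d) ((Fin d → Fin n) × Fin d) ℂ)
    (hDG : DeltaATw n M a ω * blockOp n M G = 1) (hGpsd : ∀ q, (G q).PosSemidef)
    (hG : ∀ (q : Tor M) (α β : Option (Fin d)),
      ‖sandwich (wTw n M ω α q) (wTw n M ω β q) (G q)‖ ≤ Cst d a)
    (A : Tor (fine n M) × Fin d → ℂ) :
    (1 / ((d + 1 : ℝ) * Cst d a)) * ∑ w, ‖A w‖ ^ 2 ≤ (star A ⬝ᵥ (DeltaATw n M a ω *ᵥ A)).re := by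
  have hC1 : (1 : ℝ) ≤ Cst d a := one_le_Cst a
  have hC : 0 < (d + 1 : ℝ) * Cst d a := by positivity
  have h := form_LapOneTw_le n M a ω G hDG hGpsd hG A
  have hnone : nsq (VbTw n M ω none *ᵥ A) = ∑ w, ‖A w‖ ^ 2 := by
    show nsq ((1 : Matrix (Tor (fine n M) × Fin d) (Tor (fine n M) × Fin d) ℂ) *ᵥ A) = _
    rw [Matrix.one_mulVec]
    rfl
  have hle : ∑ w, ‖A w‖ ^ 2 ≤ ∑ α, nsq (VbTw n M ω α *ᵥ A) := by
    rw [← hnone]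
    exact Finset.single_le_sum (f := fun α : Option (Fin d) => nsq (VbTw n M ω α *ᵥ A))
      (fun α _ => nsq_nonneg _) (Finset.mem_univ none)
  have key := hle.trans h
  rw [div_mul_eq_mul_div, one_mul, div_le_iff₀ hC]
  linarith

end Coercivity

end

end Literature.MathematicalPhysics.QuantumFieldTheory.Balaban1983to89.B5ToronEq190
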